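import Mathlib.Analysis.SpecialFunctions.SmoothTransition
import Mathlib.Analysis.Calculus.Deriv.MeanValue
import Mathlib.Analysis.SpecialFunctions.ExpDeriv

/-!
# Route EIHFluxBalance — `InertialRecession`: strictly monotone smooth clamps

Helper file for the crux `stmt-FinalStateConjecture-10166`
(`Summit.FinalStateConjecture.FinalStateConjecture.Theses.EIHFluxBalance.InertialRecession`).

Hole charts of a `FinalStateDecomposition` must be smooth open embeddings of WHOLE boosted Kerr
exteriors, although the lab chart of the hypothesis is only available late and away from the
other holes. The re-charting maps therefore clamp the lab time above a threshold and the rest-frame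
offsets into a slowly growing cube — and, to remain EMBEDDINGS, the clamps must be strictly
monotone (the clamp `τ₀ + 1 + (s − τ₀ − 1)·smoothTransition(s − τ₀)` of the sibling files is
constant below `τ₀`, hence useless here). This file builds them from Mathlib's `expNegInvGlue`
`e(u) = exp(−1/u)` (`u > 0`), `0` (`u ≤ 0`), via the **half clamp**
`G(u) = u / (1 + u·e(u))`: smooth, `G = id` on `(−∞, 0]`, `G < 1`, `G' = (1 − e)/(1 + u e)² > 0`.

* `exists_halfClamp` — `G`;
* `exists_strictTimeClamp'` (registered form unprimed) — `σ(s) = −G(−s)`: smooth, strictly increasing, `σ > −1`, `σ = id` on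
  `[0, ∞)`;
* `exists_coordClamp'` (registered form unprimed) — `G̃(u) = −H(−H(u))`, `H(u) = (1 + G(2u − 1))/2`: smooth, strictly
  increasing, `|G̃| < 1`, `G̃ = id` on `[−1/2, 1/2]`, `|G̃| > 1/2` off it, `|G̃ u| ≤ |u|`.
-/

noncomputable section

open Set Filter Topology
open scoped ContDiff

namespace Summit.FinalStateConjecture.FinalStateConjecture.Theorems

/-- `u² · e'(u) = e(u)` for Mathlib's `expNegInvGlue` `e` (for `u > 0`, `(exp(−1/u))' =
exp(−1/u)/u²`; both sides vanish for `u ≤ 0`). [folklore] -/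
theorem sq_mul_deriv_expNegInvGlue (u : ℝ) :
    u ^ 2 * deriv expNegInvGlue u = expNegInvGlue u := by
  rcases lt_trichotomy u 0 with hu | rfl | hu
  · have hev : expNegInvGlue =ᶠ[𝓝 u] fun _ ↦ (0 : ℝ) := by
      filter_upwards [Iio_mem_nhds hu] with x hx
      exact expNegInvGlue.zero_of_nonpos (le_of_lt hx)
    rw [hev.deriv_eq, deriv_const, mul_zero, expNegInvGlue.zero_of_nonpos hu.le]
  · rw [expNegInvGlue.zero]
    ring
  · have hev : expNegInvGlue =ᶠ[𝓝 u] fun x ↦ Real.exp (-x⁻¹) := by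
      filter_upwards [Ioi_mem_nhds hu] with x hx
      simp [expNegInvGlue, not_le.mpr (mem_Ioi.mp hx)]
    have hd : HasDerivAt (fun x : ℝ ↦ Real.exp (-x⁻¹)) (Real.exp (-u⁻¹) * (u ^ 2)⁻¹) u := by
      have h1 := (hasDerivAt_inv hu.ne').neg
      rw [neg_neg] at h1
      exact h1.exp
    rw [hev.deriv_eq, hd.deriv]
    have he : expNegInvGlue u = Real.exp (-u⁻¹) := by simp [expNegInvGlue, not_le.mpr hu]
    rw [he]
    field_simp

/-- `e(u) < 1` for Mathlib's `expNegInvGlue`. [folklore] -/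
theorem expNegInvGlue_lt_one (u : ℝ) : expNegInvGlue u < 1 := by
  rcases le_or_gt u 0 with hu | hu
  · rw [expNegInvGlue.zero_of_nonpos hu]
    exact zero_lt_one
  · have he : expNegInvGlue u = Real.exp (-u⁻¹) := by simp [expNegInvGlue, not_le.mpr hu]
    rw [he, Real.exp_lt_one_iff]
    simp [hu]

/-- **The half clamp** `G(u) = u/(1 + u e(u))`: a smooth strictly increasing function which is the
identity on `(−∞, 0]`, takes values `< 1`, satisfies `0 < G(u) ≤ u` for `u > 0`, and has
everywhere positive derivative `G' = (1 − e)/(1 + u e)²`. [folklore] -/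
theorem exists_halfClamp :
    ∃ G : ℝ → ℝ, ContDiff ℝ ∞ G ∧ (∀ u, u ≤ 0 → G u = u) ∧ (∀ u, G u < 1) ∧ (∀ u, G u ≤ u) ∧
      (∀ u, 0 < u → 0 < G u) ∧ (∀ u, 0 < deriv G u) ∧ StrictMono G := by
  set e : ℝ → ℝ := expNegInvGlue with he
  have hue : ∀ u, 0 ≤ u * e u := by
    intro u
    rcases le_or_gt u 0 with hu | hu
    · rw [he, expNegInvGlue.zero_of_nonpos hu, mul_zero]
    · exact mul_nonneg hu.le (expNegInvGlue.nonneg u)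
  have hd : ∀ u, 0 < 1 + u * e u := fun u ↦ by linarith [hue u]
  have hd1 : ∀ u, 1 ≤ 1 + u * e u := fun u ↦ by linarith [hue u]
  set G : ℝ → ℝ := fun u ↦ u / (1 + u * e u) with hG
  have hGe : ContDiff ℝ ∞ e := expNegInvGlue.contDiff
  have hGc : ContDiff ℝ ∞ G :=
    contDiff_id.div (contDiff_const.add (contDiff_id.mul hGe)) fun u ↦ (hd u).ne'
  have hGid : ∀ u, u ≤ 0 → G u = u := by
    intro u hu
    simp only [hG, he, expNegInvGlue.zero_of_nonpos hu, mul_zero, add_zero, div_one]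
  have hGlt : ∀ u, G u < 1 := by
    intro u
    rcases le_or_gt u 0 with hu | hu
    · rw [hGid u hu]; linarith
    · have heu : e u = Real.exp (-u⁻¹) := by simp [he, expNegInvGlue, not_le.mpr hu]
      rw [hG]
      simp only
      rw [div_lt_one (hd u), heu]
      have h1 := Real.add_one_lt_exp (x := -u⁻¹) (by simp [hu.ne'])
      have h2 : u * (-u⁻¹ + 1) < u * Real.exp (-u⁻¹) := mul_lt_mul_of_pos_left h1 hu
      have h3 : u * (-u⁻¹ + 1) = u - 1 := by field_simp; ring
      linarith
  have hGle : ∀ u, G u ≤ u := by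
    intro u
    rcases le_or_gt u 0 with hu | hu
    · rw [hGid u hu]
    · exact div_le_self hu.le (hd1 u)
  have hGpos : ∀ u, 0 < u → 0 < G u := fun u hu ↦ div_pos hu (hd u)
  have hGd : ∀ u, HasDerivAt G ((1 - e u) / (1 + u * e u) ^ 2) u := by
    intro u
    have h1 : HasDerivAt (fun x ↦ 1 + x * e x) (1 * e u + u * deriv e u) u :=
      (((hasDerivAt_id u).mul (hGe.differentiable (by simp) u).hasDerivAt)).const_add 1
    have h2 : HasDerivAt (fun x ↦ x / (1 + x * e x))
        ((1 * (1 + u * e u) - u * (1 * e u + u * deriv e u)) / (1 + u * e u) ^ 2) u :=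
      (hasDerivAt_id' u).div h1 (hd u).ne'
    have hkey : u ^ 2 * deriv e u = e u := sq_mul_deriv_expNegInvGlue u
    refine h2.congr_deriv ?_
    rw [← hkey]
    ring
  have hGd' : ∀ u, 0 < deriv G u := by
    intro u
    rw [(hGd u).deriv]
    exact div_pos (by linarith [expNegInvGlue_lt_one u]) (pow_pos (hd u) 2)
  exact ⟨G, hGc, hGid, hGlt, hGle, hGpos, hGd', strictMono_of_deriv_pos hGd'⟩

/-- **Strictly monotone time clamp** `σ(s) = −G(−s)`: smooth, strictly increasing, `σ > −1`,
`σ(s) = s` for `s ≥ 0`, `s ≤ σ(s)`, `σ' > 0`. Used as `θ = T + 1 + σ(w − T − 1)`: a smooth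
strictly increasing reparametrisation of the time axis onto `(T, ∞)`, the identity on `[T + 1, ∞)`.
[folklore] -/
theorem exists_strictTimeClamp' :
    ∃ σ : ℝ → ℝ, ContDiff ℝ ∞ σ ∧ StrictMono σ ∧ (∀ s, -1 < σ s) ∧ (∀ s, 0 ≤ s → σ s = s) ∧
      (∀ s, s ≤ σ s) ∧ ∀ s, 0 < deriv σ s := by
  obtain ⟨G, hGc, hGid, hGlt, hGle, -, hGd, hGm⟩ := exists_halfClamp
  refine ⟨fun s ↦ -G (-s), (hGc.comp contDiff_neg).neg, fun a b hab ↦ ?_, fun s ↦ ?_,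
    fun s hs ↦ ?_, fun s ↦ ?_, fun s ↦ ?_⟩
  · exact neg_lt_neg (hGm (neg_lt_neg hab))
  · linarith [hGlt (-s)]
  · show -G (-s) = s
    rw [hGid (-s) (by linarith), neg_neg]
  · show s ≤ -G (-s)
    linarith [hGle (-s)]
  · have hGdiff : Differentiable ℝ G := hGc.differentiable (by simp)
    have h1 : HasDerivAt (fun s ↦ -G (-s)) (-(deriv G (-s) * -1)) s :=
      (((hGdiff (-s)).hasDerivAt.comp s (hasDerivAt_neg s))).neg
    rw [h1.deriv]
    have := hGd (-s)
    linarith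

/-- **Two-sided coordinate clamp** `G̃(u) = −H(−H(u))` with `H(u) = (1 + G(2u − 1))/2`: smooth,
strictly increasing, `|G̃| < 1`, the identity on `[−1/2, 1/2]`, `|G̃ u| > 1/2` when `|u| > 1/2`,
`|G̃ u| ≤ |u|`, `G̃' > 0`. Applied coordinatewise at scale `ρ` it maps `E3` diffeomorphically
into the cube `(−ρ, ρ)³`, fixing the cube `[−ρ/2, ρ/2]³`. [folklore] -/
theorem exists_coordClamp' :
    ∃ Gt : ℝ → ℝ, ContDiff ℝ ∞ Gt ∧ StrictMono Gt ∧ (∀ u, |Gt u| < 1) ∧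
      (∀ u, |u| ≤ 1 / 2 → Gt u = u) ∧ (∀ u, 1 / 2 < |u| → 1 / 2 < |Gt u|) ∧
      (∀ u, |Gt u| ≤ |u|) ∧ ∀ u, 0 < deriv Gt u := by
  obtain ⟨G, hGc, hGid, hGlt, hGle, hGpos, hGd, hGm⟩ := exists_halfClamp
  have hGdiff : Differentiable ℝ G := hGc.differentiable (by simp)
  -- the upper clamp `H`
  set H : ℝ → ℝ := fun u ↦ (1 + G (2 * u - 1)) / 2 with hH
  have hHc : ContDiff ℝ ∞ H :=
    (contDiff_const.add (hGc.comp ((contDiff_const.mul contDiff_id).sub contDiff_const))).div_const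
      _
  have hHid : ∀ u, u ≤ 1 / 2 → H u = u := by
    intro u hu
    show (1 + G (2 * u - 1)) / 2 = u
    rw [hGid _ (by linarith)]
    ring
  have hHlt : ∀ u, H u < 1 := by
    intro u
    show (1 + G (2 * u - 1)) / 2 < 1
    linarith [hGlt (2 * u - 1)]
  have hHle : ∀ u, H u ≤ u := by
    intro u
    show (1 + G (2 * u - 1)) / 2 ≤ u
    linarith [hGle (2 * u - 1)]
  have hHgt : ∀ u, 1 / 2 < u → 1 / 2 < H u := by
    intro u hu
    show 1 / 2 < (1 + G (2 * u - 1)) / 2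
    linarith [hGpos (2 * u - 1) (by linarith)]
  have hHpos : ∀ u, 0 < u → 0 < H u := by
    intro u hu
    rcases le_or_gt u (1 / 2) with h | h
    · rw [hHid u h]; exact hu
    · linarith [hHgt u h]
  have hHm : StrictMono H := by
    intro a b hab
    show (1 + G (2 * a - 1)) / 2 < (1 + G (2 * b - 1)) / 2
    linarith [hGm (show 2 * a - 1 < 2 * b - 1 by linarith)]
  have hHd : ∀ u, HasDerivAt H (deriv G (2 * u - 1)) u := by
    intro u
    have h1 : HasDerivAt (fun u ↦ 2 * u - 1) (2 * 1) u :=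
      ((hasDerivAt_id u).const_mul 2).sub_const 1
    have h2 : HasDerivAt (fun x ↦ G (2 * x - 1)) (deriv G (2 * u - 1) * (2 * 1)) u :=
      (hGdiff (2 * u - 1)).hasDerivAt.comp u h1
    have h3 : HasDerivAt (fun x ↦ (1 + G (2 * x - 1)) / 2) (deriv G (2 * u - 1) * (2 * 1) / 2) u :=
      (h2.const_add 1).div_const 2
    refine h3.congr_deriv ?_
    ring
  have hHdiff : Differentiable ℝ H := hHc.differentiable (by simp)
  -- the two-sided clamp
  refine ⟨fun u ↦ -H (-H u), (hHc.comp (hHc.neg)).neg, fun a b hab ↦ ?_, fun u ↦ ?_,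
    fun u hu ↦ ?_, fun u hu ↦ ?_, fun u ↦ ?_, fun u ↦ ?_⟩
  · exact neg_lt_neg (hHm (neg_lt_neg (hHm hab)))
  · -- `|G̃ u| < 1`
    show |-H (-H u)| < 1
    rcases le_or_gt u (1 / 2) with h | h
    · rw [hHid u h]
      rcases le_or_gt (-u) (1 / 2) with h' | h'
      · rw [hHid _ h', neg_neg, abs_lt]; constructor <;> linarith
      · have h1 := hHgt _ h'
        have h2 := hHlt (-u)
        rw [abs_lt]; constructor <;> linarith
    · have h1 := hHgt u h
      have h2 := hHlt u
      rw [hHid _ (by linarith), neg_neg, abs_lt]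
      constructor <;> linarith
  · -- identity on `[−1/2, 1/2]`
    rw [abs_le] at hu
    show -H (-H u) = u
    rw [hHid u hu.2, hHid _ (by linarith), neg_neg]
  · -- `|G̃ u| > 1/2` off the cube
    show 1 / 2 < |-H (-H u)|
    rcases lt_or_gt_of_ne (show u ≠ 0 by intro h0; rw [h0, abs_zero] at hu; linarith) with h | h
    · have hu' : 1 / 2 < -u := by rw [abs_of_neg h] at hu; exact hu
      rw [hHid u (by linarith)]
      have h1 := hHgt _ hu'
      rw [abs_of_neg (by linarith)]
      linarith
    · have hu' : 1 / 2 < u := by rw [abs_of_pos h] at hu; exact hu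
      have h1 := hHgt u hu'
      rw [hHid _ (by linarith), neg_neg, abs_of_pos (by linarith)]
      exact h1
  · -- `|G̃ u| ≤ |u|`
    show |-H (-H u)| ≤ |u|
    rcases le_or_gt u (1 / 2) with h | h
    · rw [hHid u h]
      rcases le_or_gt (-u) (1 / 2) with h' | h'
      · rw [hHid _ h', neg_neg]
      · have h1 := hHle (-u)
        have h2 := hHgt _ h'
        rw [abs_of_nonpos (by linarith), abs_of_neg (by linarith)]
        linarith
    · have h1 := hHle u
      have h2 := hHgt u h
      rw [hHid _ (by linarith), neg_neg, abs_of_pos (by linarith), abs_of_pos (by linarith)]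
      exact h1
  · -- `G̃' > 0`
    have h1 : HasDerivAt (fun u ↦ -H u) (-deriv G (2 * u - 1)) u := (hHd u).neg
    have h2 : HasDerivAt (fun u ↦ -H (-H u))
        (-(deriv G (2 * (-H u) - 1) * -deriv G (2 * u - 1))) u :=
      (HasDerivAt.comp u (h₂ := H) (hHd (-H u)) h1).neg
    rw [h2.deriv]
    have := hGd (2 * -H u - 1)
    have := hGd (2 * u - 1)
    nlinarith

/-! ### Registered forms -/

/-- Registered sub-goal form (stub `exists_strictTimeClamp` of the crux item) of
`exists_strictTimeClamp'`. [folklore] -/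
theorem exists_strictTimeClamp : ∃ σ : ℝ → ℝ, ContDiff ℝ ((⊤ : ℕ∞) : WithTop ℕ∞) σ ∧ StrictMono σ ∧ (∀ s, -1 < σ s) ∧ (∀ s, 0 ≤ s → σ s = s) ∧ (∀ s, s ≤ σ s) ∧ ∀ s, 0 < deriv σ s :=
  exists_strictTimeClamp'

/-- Registered sub-goal form (stub `exists_coordClamp` of the crux item) of `exists_coordClamp'`.
[folklore] -/
theorem exists_coordClamp : ∃ Gt : ℝ → ℝ, ContDiff ℝ ((⊤ : ℕ∞) : WithTop ℕ∞) Gt ∧ StrictMono Gt ∧ (∀ u, |Gt u| < 1) ∧ (∀ u, |u| ≤ 1 / 2 → Gt u = u) ∧ (∀ u, 1 / 2 < |u| → 1 / 2 < |Gt u|) ∧ (∀ u, |Gt u| ≤ |u|) ∧ ∀ u, 0 < deriv Gt u :=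
  exists_coordClamp'

end Summit.FinalStateConjecture.FinalStateConjecture.Theorems

end
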